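import Literature.Computability.AlgebraicComplexity.BorderRankCW
import Mathlib.Analysis.SpecialFunctions.Log.Base
import HarnessLib

/-!
# The laser-method bound for the skew little Coppersmith–Winograd tensor (CGLV 2022, §2.2)

Topic `Literature/Computability/AlgebraicComplexity` (route `MatrixMultiplication/AsymptoticRankCW`,
glue item `GlueDet3Omega` = `stmt-MatrixMultiplication-1889`, which needs the skew analogue of the
PROVED `CoppersmithWinograd1990_asymptoticRank_form_holds` and currently exits
"blocked: needs CGLV2022 Prop 2.2 (skew CW90 bound)").

A. Conner, F. Gesmundo, J. M. Landsberg, E. Ventura, *Rank and border rank of Kronecker powers of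
tensors and Strassen's laser method*, comput. complexity 31 (2022) = arXiv:1909.04785
[`ConnerGesmundoLandsbergVentura2022`], read in the held copy `paper:arxiv-1909.04785` (chunk p. 5,
§2.2 "A skew cousin of `T_{cw,q}`"): after defining
`T_{skewcw,q} := ∑_{j=1}^q a₀⊗b_j⊗c_j + a_j⊗b₀⊗c_j + ∑_{ξ=1}^{q/2} (a_ξ⊗b_{ξ+q/2} − a_{ξ+q/2}⊗b_ξ)⊗c₀`
(their eq. (3) = the tree's `skewCwTensor ℂ u`, `q = 2u`), the authors write: "In the language of
[BCS], `T_{skewcw,q}` has the same block structure as `T_{cw,q}`, which immediately implies Theorem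
(cwbndk) also holds for `T_{skewcw,q}`: **Theorem 2.5.** For all `k`,
`ω ≤ log_q((4/27) (bR(T_{skewcw,q}^{⊠k}))^{3/k})`. In particular, the known barriers do not apply to
`T_{skewcw,2}` for proving `ω = 2` […]" and (chunk p. 5, before Lemma 2.4) "`R̃(T_{skewcw,2}) = 3`
would imply `ω = 2`". (arXiv v3 numbering "Theorem 2.5"; the journal renumbers §2.2's statement —
quoted by the route planner as "Prop. 2.2".) Theorem (cwbndk) is their Thm. 1.1 (arXiv Thm. 1.2,
Coppersmith–Winograd 1990 / BCS97 Ex. 15.24), vendored for `T_{cw,q}` in `CoppersmithWinograd1990.lean`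
and PROVED there (`CoppersmithWinograd1990Proofs.lean`).

This file records the skew statement as named literature facts (Props, D-0014), in the same three
shapes as the `T_{cw,q}` file:

* `CGLV2022_skewCw_borderRank_form` — VERBATIM Thm. 2.5: border rank `bR` = the tree's algebraic
  border rank `algBorderRank` (over `ℂ[ε]`, `SchoenhageTau.lean`), Kronecker power = `kroneckerPow`
  (`AsymptoticSpectrum.lean`), `q = 2u` with `u ≥ 1`, `k ≥ 1`.
* `CGLV2022_skewCw_rank_form` — the same with rank in place of border rank (a COROLLARY in print,
  since `bR ≤ R` and `log_q` is monotone for `q ≥ 2`).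
* `CGLV2022_skewCw_asymptoticRank_form` — the asymptotic-rank form "`R̃(T_{skewcw,q}) ≤ ρ ⟹
  ω ≤ log_q(4ρ³/27)`" with `R̃ ≤ ρ` unfolded as the growth bound `R(T^{⊠N}) = O(ρ^{(1+ε)N})` for every
  `ε > 0`, exactly as `CoppersmithWinograd1990_asymptoticRank_form`; a corollary in print of Thm. 2.5
  for all `k` (BCS97 remark quoted by CGLV p. 4: "the statement holds with `bR(T^{⊠k})^{3/k}` replaced
  by `R̃(T)³`", applied to the skew tensor through "Theorem (cwbndk) also holds for `T_{skewcw,q}`").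
  With `u = 1`, `ρ = 3` it gives `ω ≤ log₂(4·27/27) = 2` — the implication the route's glue
  `Summit.MatrixMultiplication.MatrixMultiplication.Theses.AsymptoticRankCW.GlueDet3Omega` consumes.

Nothing is proved here; a prover discharges these by running the laser analysis of
`CoppersmithWinograd1990Proofs.lean` on the block support `{(0,j,j),(j,0,j),(j,j,0)}` of
`skewCwTensor` (the `(·,·,0)` block being the non-degenerate skew form `≅ ⟨1,q,1⟩`).
-/

noncomputable section

open scoped BigOperators
open Filter Asymptotics

namespace Literature.Computability.AlgebraicComplexity

/-- **CGLV 2022, §2.2 (arXiv Thm. 2.5), border-rank form, verbatim**: for every even `q = 2u ≥ 2`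
and every `k ≥ 1`, `ω(ℂ) ≤ log_q((4/27) · bR(T_{skewcw,q}^{⊠k})^{3/k})`, with `bR` the algebraic
border rank `algBorderRank` and `T^{⊠k} = kroneckerPow T k`. "Theorem (cwbndk) [= Thm. 1.1, the
Coppersmith–Winograd bound for `T_{cw,q}`] also holds for `T_{skewcw,q}`." Named literature fact;
users take `(h : CGLV2022_skewCw_borderRank_form)`.
[cite: ConnerGesmundoLandsbergVentura2022, §2.2 Thm. 2.5 (arXiv:1909.04785 numbering; eq. (3) for the tensor)] -/
def CGLV2022_skewCw_borderRank_form : Prop :=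
  ∀ u k : ℕ, 1 ≤ u → 1 ≤ k →
    omega ℂ ≤ Real.logb (2 * u) ((4 / 27) *
      ((algBorderRank (kroneckerPow (skewCwTensor ℂ u) k) : ℝ) ^ ((3 : ℝ) / k)))

/-- **CGLV 2022, §2.2 (arXiv Thm. 2.5), rank form** (corollary in print of the border-rank form,
`bR ≤ R`): for every even `q = 2u ≥ 2` and `k ≥ 1`,
`ω(ℂ) ≤ log_q((4/27) · R(T_{skewcw,q}^{⊠k})^{3/k})`. Named literature fact.
[cite: ConnerGesmundoLandsbergVentura2022, §2.2 Thm. 2.5 (arXiv numbering), with bR ≤ R] -/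
def CGLV2022_skewCw_rank_form : Prop :=
  ∀ u k : ℕ, 1 ≤ u → 1 ≤ k →
    omega ℂ ≤ Real.logb (2 * u) ((4 / 27) *
      ((tensorRank (K := ℂ) (kroneckerPow (skewCwTensor ℂ u) k) : ℝ) ^ ((3 : ℝ) / k)))

/-- **CGLV 2022, §2.2, asymptotic-rank form** ("`R̃(T_{skewcw,2}) = 3` would imply `ω = 2`", p. 5;
the BCS97 remark "Thm. 1.1 holds with `bR(T^{⊠k})^{3/k}` replaced by `R̃(T)³`" transported to the skew
tensor by "Theorem (cwbndk) also holds for `T_{skewcw,q}`"): for `q = 2u ≥ 2` and `ρ > 0`, if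
`R(T_{skewcw,q}^{⊠N}) = O(ρ^{(1+ε)N})` for every `ε > 0` (i.e. `R̃(T_{skewcw,q}) ≤ ρ`, unfolded as in
`CoppersmithWinograd1990_asymptoticRank_form`), then `ω(ℂ) ≤ log_q(4ρ³/27)`. A corollary in print of
Thm. 2.5 for all `k` and `R̃ = lim R(T^{⊠k})^{1/k}`. Grounds the glue item
`Summit.MatrixMultiplication.MatrixMultiplication.Theses.AsymptoticRankCW.GlueDet3Omega`
(`u = 1`, `ρ = 3`: `ω ≤ log₂ 4 = 2`). Named literature fact.
[cite: ConnerGesmundoLandsbergVentura2022, §2.2 Thm. 2.5 and the remark before Lemma 2.4 (arXiv numbering); p. 4 (BCS97 Ex. 15.24 remark)] -/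
def CGLV2022_skewCw_asymptoticRank_form : Prop :=
  ∀ u : ℕ, 1 ≤ u → ∀ ρ : ℝ, 0 < ρ →
    (∀ ε : ℝ, 0 < ε →
      (fun N : ℕ => (tensorRank (K := ℂ) (kroneckerPow (skewCwTensor ℂ u) N) : ℝ)) =O[atTop]
        fun N : ℕ => ρ ^ ((1 + ε) * N)) →
    omega ℂ ≤ Real.logb (2 * u) (4 * ρ ^ 3 / 27)

/-- Sanity numerology for the route: at `u = 1`, `ρ = 3` the conclusion of the asymptotic-rank form
reads `ω ≤ log₂(4·3³/27) = 2`. [folklore] -/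
theorem logb_two_mul_one_skew (h : CGLV2022_skewCw_asymptoticRank_form)
    (hgrowth : ∀ ε : ℝ, 0 < ε →
      (fun N : ℕ => (tensorRank (K := ℂ) (kroneckerPow (skewCwTensor ℂ 1) N) : ℝ)) =O[atTop]
        fun N : ℕ => (3 : ℝ) ^ ((1 + ε) * N)) :
    omega ℂ ≤ 2 := by
  have h1 := h 1 le_rfl 3 (by norm_num) hgrowth
  have h0 : ((2 : ℝ) * ((1 : ℕ) : ℝ)) = 2 := by norm_num
  have h2 : Real.logb 2 (4 * (3 : ℝ) ^ 3 / 27) = 2 := by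
    rw [show (4 * (3 : ℝ) ^ 3 / 27) = 2 ^ (2 : ℕ) by norm_num, Real.logb_pow,
      Real.logb_self_eq_one (by norm_num)]
    norm_num
  rw [h0, h2] at h1
  exact h1

end Literature.Computability.AlgebraicComplexity
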